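import Summits.Ventures.LatticeQCDFlow.Scaling.IdealStarStaleSteps
import Summits.Ventures.LatticeQCDFlow.Scaling.StaleTwoMomentSequences

/-!
HONEST FRAMING: exact (Metropolis-corrected) sampling algorithms for lattice gauge theory; figures
of merit are autocorrelation/cost numbers at stated couplings and volumes; no continuum-physics
claim.

# IdealStarStaleMoments — THE STALE LEVELS OF THE IDEALISED STAR SURVIVE THE COUPON-COLLECTOR TIME IN THE CEILING'S UNIT: FROM EVERYTHING STALE, `E Φ_n ≥ s = (1−λ)ⁿ(K+t)`,
# `Var Φ_n ≤ 16s + 9` (`λ = t(1−t)/K`, `Φ = |D∖{0}| + t𝟙{0∈D}`), HENCE `(δ_{univ}Qⁿ){Φ ≥ s/2} ≥ 1 − (64s+36)/s²` (lean-2 GEN-45, ours)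

Venture-side (OURS).  Cell `lqcd-flow` (pub-lqcd), unit `pub-lqcd-lean-2-g45`, 2026-08-31.  Chapter AE, file 11 — file 10's one-step identities summed along chapter L's stale-set
chain from `D_0 = univ` give file 9's recursions exactly (`a_n = EΦ_n`, `F_n = E|D_n∖{0}|`, `b_n = P(0 ∈ D_n)`, `q_n = EΦ_n²`; `a_0 = K+t`, `b_0 = 1`, `q_0 = a_0²`,
`κ = t/K`, `C₁ = λ(1−t)`, `C₂ = 3t(1−t) + 2λt²`), so `EΦ_n ≥ (1−λ)ⁿ(K+t)` and `Var Φ_n ≤ γ(1−λ)ⁿ/λ + δ/(2λ)`; the constants are chased to `16·(1−λ)ⁿ(K+t) + 9` (`0 < t < 1`,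
`K ≥ 2`), and Chebyshev gives the survival of the stale levels (`|D| ≥ Φ(D)`).

* **`idealStar_stalePotential_twoMoment`** (the symbolic two-moment bound), `stale_consts_le` (the constant chase), **`idealStar_stalePotential_moments`** (`EΦ_n ≥ s`, `Var ≤ 16s + 9`),
  **`idealStar_stalePotential_mass_ge`** (`(δ_{univ}Qⁿ){D : s/2 ≤ Φ(D)} ≥ 1 − (64s + 36)/s²`).

Reading (no numerics implied): compare file 5 (`θ = t/K`, first unit `K/t`): counting a captured-but-not-yet-refreshed unit at its survival odds `t` is what recovers the refresh
factor `1/(1−t)`; file 12 feeds this into file 7's argument.  Literature grade (cell rule): OWN (two-moment method); nothing cited as a fact; no new bib keys.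
-/

noncomputable section

open Finset Function
open Literature.Probability.MarkovChains

namespace Summit.Ventures.LatticeQCDFlow.Scaling

/-! ## §1 The constant chase (pure real arithmetic) -/

/-- With `λ = t(1−t)/K`, `κ = t/K`, `0 < t < 1`, `K ≥ 2`, `0 ≤ x ≤ 1`:
`(λ(1−t)(K+t) + (3t(1−t)+2λt²)(κ(K+t)/(1−λ) + 1))·x/λ + (λ(1−t) + (3t(1−t)+2λt²)κ)·t(1 + κ(K+t))/(2λ) ≤ 16x(K+t) + 9`. [ours] -/
theorem stale_consts_le {t K : ℝ} (ht0 : 0 < t) (ht1 : t < 1) (hK : 2 ≤ K) {x : ℝ} (hx0 : 0 ≤ x) :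
    (t * (1 - t) / K * (1 - t) * (K + t) + (3 * (t * (1 - t)) + 2 * (t * (1 - t) / K) * t ^ 2) * (t / K * (K + t) / (1 - t * (1 - t) / K) + 1)) * x / (t * (1 - t) / K)
        + (t * (1 - t) / K * (1 - t) + (3 * (t * (1 - t)) + 2 * (t * (1 - t) / K) * t ^ 2) * (t / K)) * (t * (1 + t / K * (K + t))) / (2 * (t * (1 - t) / K))
      ≤ 16 * (x * (K + t)) + 9 := by
  have hKpos : 0 < K := by linarith
  have h1t : 0 < 1 - t := by linarith
  have hKt : 0 ≤ K + t := by linarith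
  set lam : ℝ := t * (1 - t) / K with hlam
  set kap : ℝ := t / K with hkap
  have hlam0 : 0 < lam := div_pos (mul_pos ht0 h1t) hKpos
  have htt : t * (1 - t) ≤ 1 / 4 := by nlinarith [sq_nonneg (t - 1 / 2)]
  have hlamle : lam ≤ 1 / 8 := by
    rw [hlam, div_le_iff₀ hKpos]; linarith
  have h1lam : 0 < 1 - lam := by linarith
  have hkap0 : 0 ≤ kap := div_nonneg ht0.le hKpos.le
  have ht2 : t ^ 2 ≤ t := by nlinarith
  -- `κ(K+t) = t + t²/K ≤ 3/2`
  have hkK : kap * (K + t) ≤ 3 / 2 := by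
    have e : kap * (K + t) = t + t ^ 2 / K := by rw [hkap]; field_simp
    have h1 : t ^ 2 / K ≤ 1 / 2 := by rw [div_le_iff₀ hKpos]; nlinarith
    rw [e]; linarith
  have hkK0 : 0 ≤ kap * (K + t) := mul_nonneg hkap0 hKt
  -- `κ(K+t)/(1−λ) ≤ 2`
  have hfrac : kap * (K + t) / (1 - lam) ≤ 2 := by rw [div_le_iff₀ h1lam]; linarith
  have hfrac0 : 0 ≤ kap * (K + t) / (1 - lam) := div_nonneg hkK0 h1lam.le
  -- `C₂ = 3t(1−t) + 2λt² = 3λK + 2λt² ≤ λ(3K + 2)`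
  have hC2eq : 3 * (t * (1 - t)) = 3 * lam * K := by rw [hlam]; field_simp
  have hC2 : 3 * (t * (1 - t)) + 2 * lam * t ^ 2 ≤ lam * (3 * K + 2) := by
    have h1 : lam * t ^ 2 ≤ lam * 1 := mul_le_mul_of_nonneg_left (by nlinarith) hlam0.le
    rw [hC2eq]; linarith
  have hC20 : 0 ≤ 3 * (t * (1 - t)) + 2 * lam * t ^ 2 := by positivity
  have hlamK : 0 ≤ lam * (3 * K + 2) := by positivity
  -- `γ ≤ 16λ(K+t)`
  have hγ : lam * (1 - t) * (K + t) + (3 * (t * (1 - t)) + 2 * lam * t ^ 2) * (kap * (K + t) / (1 - lam) + 1) ≤ 16 * lam * (K + t) := by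
    have h1 : lam * (1 - t) * (K + t) ≤ lam * 1 * (K + t) := mul_le_mul_of_nonneg_right (mul_le_mul_of_nonneg_left (by linarith) hlam0.le) hKt
    have h2 : (3 * (t * (1 - t)) + 2 * lam * t ^ 2) * (kap * (K + t) / (1 - lam) + 1) ≤ lam * (3 * K + 2) * 3 :=
      mul_le_mul hC2 (by linarith) (by linarith) hlamK
    have h3 : lam * (3 * K + 2) * 3 + lam * 1 * (K + t) ≤ 16 * lam * (K + t) := by
      have : lam * (6 - 5 * K - 15 * t) ≤ 0 := mul_nonpos_of_nonneg_of_nonpos hlam0.le (by linarith)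
      nlinarith
    linarith
  -- `δ ≤ 18λ`
  have hδ : (lam * (1 - t) + (3 * (t * (1 - t)) + 2 * lam * t ^ 2) * kap) * (t * (1 + kap * (K + t))) ≤ 18 * lam := by
    have h1 : (3 * (t * (1 - t)) + 2 * lam * t ^ 2) * kap ≤ lam * (3 * K + 2) * kap := mul_le_mul_of_nonneg_right hC2 hkap0
    have h2 : lam * (3 * K + 2) * kap ≤ 4 * lam := by
      have e : lam * (3 * K + 2) * kap = lam * (3 * t + 2 * t / K) := by rw [hkap]; field_simp
      have h21 : 2 * t / K ≤ 1 := by rw [div_le_iff₀ hKpos]; linarith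
      rw [e]; nlinarith
    have h3 : lam * (1 - t) + (3 * (t * (1 - t)) + 2 * lam * t ^ 2) * kap ≤ 5 * lam := by nlinarith
    have h4 : t * (1 + kap * (K + t)) ≤ 1 * (5 / 2) := mul_le_mul ht1.le (by linarith) (by linarith) zero_le_one
    have h5 : 0 ≤ t * (1 + kap * (K + t)) := by positivity
    calc (lam * (1 - t) + (3 * (t * (1 - t)) + 2 * lam * t ^ 2) * kap) * (t * (1 + kap * (K + t))) ≤ 5 * lam * (1 * (5 / 2)) := mul_le_mul h3 h4 h5 (by positivity)
      _ ≤ 18 * lam := by linarith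
  -- assemble
  have hA : (lam * (1 - t) * (K + t) + (3 * (t * (1 - t)) + 2 * lam * t ^ 2) * (kap * (K + t) / (1 - lam) + 1)) * x / lam ≤ 16 * (x * (K + t)) := by
    rw [div_le_iff₀ hlam0]
    have h := mul_le_mul_of_nonneg_right hγ hx0
    have e : 16 * (x * (K + t)) * lam = 16 * lam * (K + t) * x := by ring
    rw [e]; exact h
  have hB : (lam * (1 - t) + (3 * (t * (1 - t)) + 2 * lam * t ^ 2) * kap) * (t * (1 + kap * (K + t))) / (2 * lam) ≤ 9 := by
    rw [div_le_iff₀ (by linarith)]; linarith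
  linarith

/-! ## §2 The two moments along the chain -/

section StaleMoments
variable {K m : ℕ} (κ : Fin m → Fin K) {t : ℝ} {Q : Finset (Fin (K + 1)) → Finset (Fin (K + 1)) → ℝ}

/-- **THE SYMBOLIC TWO-MOMENT BOUND:** from `D_0 = univ`, with `λ = t(1−t)/K`, `κ = t/K` (`0 < t < 1`, `K ≥ 2`, `m = cK`): `EΦ_n ≥ (1−λ)ⁿ(K+t)` and
`EΦ_n² − (EΦ_n)² ≤ (λ(1−t)(K+t) + (3t(1−t)+2λt²)(κ(K+t)/(1−λ) + 1))(1−λ)ⁿ/λ + (λ(1−t) + (3t(1−t)+2λt²)κ)·t(1 + κ(K+t))/(2λ)` (file 9). [ours] -/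
theorem idealStar_stalePotential_twoMoment (hm : 1 ≤ m) (ht0 : 0 < t) (ht1 : t < 1) (hK : 2 ≤ K)
    (hQ : ∀ D D', Q D D' = ∑ r : Fin m, t / m * (if D' = D.image (Equiv.swap (0 : Fin (K + 1)) (κ r).succ) then (1 : ℝ)
      else 0) + (1 - t) * (if D' = D.erase 0 then (1 : ℝ) else 0))
    {c : ℕ} (hunif : ∀ i : Fin K, (univ.filter fun r : Fin m => κ r = i).card = c) (hmc : m = c * K) (n : ℕ) :
    (1 - t * (1 - t) / K) ^ n * ((K : ℝ) + t)
        ≤ ∑ D, lawAt Q (Pi.single (univ : Finset (Fin (K + 1))) 1) n D * (((D.erase 0).card : ℝ) + t * (if (0 : Fin (K + 1)) ∈ D then (1 : ℝ) else 0)) ∧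
      ∑ D, lawAt Q (Pi.single (univ : Finset (Fin (K + 1))) 1) n D * (((D.erase 0).card : ℝ) + t * (if (0 : Fin (K + 1)) ∈ D then (1 : ℝ) else 0)) ^ 2
          - (∑ D, lawAt Q (Pi.single (univ : Finset (Fin (K + 1))) 1) n D * (((D.erase 0).card : ℝ) + t * (if (0 : Fin (K + 1)) ∈ D then (1 : ℝ) else 0))) ^ 2
        ≤ (t * (1 - t) / K * (1 - t) * ((K : ℝ) + t) + (3 * (t * (1 - t)) + 2 * (t * (1 - t) / K) * t ^ 2) * (t / K * ((K : ℝ) + t) / (1 - t * (1 - t) / K) + 1))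
              * (1 - t * (1 - t) / K) ^ n / (t * (1 - t) / K)
          + (t * (1 - t) / K * (1 - t) + (3 * (t * (1 - t)) + 2 * (t * (1 - t) / K) * t ^ 2) * (t / K)) * (t * (1 + t / K * ((K : ℝ) + t))) / (2 * (t * (1 - t) / K)) := by
  classical
  have hK1 : 1 ≤ K := by omega
  have hKpos : (0 : ℝ) < K := by exact_mod_cast (by omega : 0 < K)
  have hK2 : (2 : ℝ) ≤ K := by exact_mod_cast hK
  have hmpos : (0 : ℝ) < m := Nat.cast_pos.mpr (by omega)
  have hcm : (c : ℝ) / m = 1 / K := by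
    rw [hmc]; push_cast
    have hc0 : (c : ℝ) ≠ 0 := by
      intro hc; rw [hmc] at hmpos; push_cast at hmpos; rw [hc, zero_mul] at hmpos; exact lt_irrefl _ hmpos
    field_simp
  have hQrs : IsRowStochastic Q := dirty_isRowStochastic κ hm ht0.le ht1.le hQ
  have hμ0 : ∀ n D, 0 ≤ lawAt Q (Pi.single (univ : Finset (Fin (K + 1))) 1) n D :=
    fun n => lawAt_nonneg hQrs (fun D => by rw [Pi.single_apply]; split_ifs <;> norm_num) n
  -- the four sequences
  set a : ℕ → ℝ := fun n => ∑ D, lawAt Q (Pi.single (univ : Finset (Fin (K + 1))) 1) n D * (((D.erase 0).card : ℝ) + t * (if (0 : Fin (K + 1)) ∈ D then (1 : ℝ) else 0)) with ha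
  set F : ℕ → ℝ := fun n => ∑ D, lawAt Q (Pi.single (univ : Finset (Fin (K + 1))) 1) n D * ((D.erase 0).card : ℝ) with hF
  set b : ℕ → ℝ := fun n => ∑ D, lawAt Q (Pi.single (univ : Finset (Fin (K + 1))) 1) n D * (if (0 : Fin (K + 1)) ∈ D then (1 : ℝ) else 0) with hb
  set q : ℕ → ℝ := fun n => ∑ D, lawAt Q (Pi.single (univ : Finset (Fin (K + 1))) 1) n D * (((D.erase 0).card : ℝ) + t * (if (0 : Fin (K + 1)) ∈ D then (1 : ℝ) else 0)) ^ 2 with hq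
  set lam : ℝ := t * (1 - t) / K with hlam
  set kap : ℝ := t / K with hkap
  have hlam0 : 0 < lam := div_pos (mul_pos ht0 (by linarith)) hKpos
  have hlamle : lam ≤ 1 / 8 := by
    rw [hlam, div_le_iff₀ hKpos]; nlinarith [sq_nonneg (t - 1 / 2)]
  have hkap0 : 0 ≤ kap := div_nonneg ht0.le hKpos.le
  -- relations
  have hFa : ∀ n, a n = F n + t * b n := fun n => by
    simp only [ha, hF, hb, mul_sum, ← sum_add_distrib]; exact sum_congr rfl fun D _ => by ring
  have hstepA : ∀ n, a (n + 1) = a n - lam * F n := by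
    intro n
    simp only [ha, hF]
    rw [lawAt_succ, compare_stepLaw_expect, sum_congr rfl fun D _ => by rw [stale_potential_step κ hm hQ hunif D], mul_sum, ← sum_sub_distrib]
    refine sum_congr rfl fun D _ => ?_
    rw [show t * (1 - t) * (c : ℝ) / m = t * (1 - t) * (c / m) by ring, hcm, hlam]; ring
  have hstepB : ∀ n, b (n + 1) = kap * F n := by
    intro n
    simp only [hb, hF]
    rw [lawAt_succ, compare_stepLaw_expect, sum_congr rfl fun D _ => by rw [stale_hub_step κ hQ hunif D], mul_sum]
    refine sum_congr rfl fun D _ => ?_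
    rw [show t * (c : ℝ) / m = t * (c / m) by ring, hcm, hkap]; ring
  have hstepQ : ∀ n, q (n + 1) ≤ (1 - 2 * lam) * q n + lam * (1 - t) * F n + (3 * (t * (1 - t)) + 2 * lam * t ^ 2) * b n := by
    intro n
    simp only [hq, hF, hb]
    rw [lawAt_succ, compare_stepLaw_expect, mul_sum, mul_sum, mul_sum, ← sum_add_distrib, ← sum_add_distrib]
    refine sum_le_sum fun D _ => ?_
    have h := mul_le_mul_of_nonneg_left (stale_potential_sq_step κ hm ht0.le ht1.le hK1 hQ hunif hmc D) (hμ0 n D)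
    refine h.trans (le_of_eq ?_)
    rw [hlam]; ring
  have hstart : ∀ f : Finset (Fin (K + 1)) → ℝ, ∑ D, lawAt Q (Pi.single (univ : Finset (Fin (K + 1))) 1) 0 D * f D = f univ := by
    intro f
    rw [lawAt_zero, Finset.sum_eq_single (univ : Finset (Fin (K + 1))) (fun D _ hD => by rw [Pi.single_apply, if_neg hD, zero_mul]) (fun h => absurd (mem_univ _) h)]
    rw [Pi.single_eq_same, one_mul]
  have hcard : ((((univ : Finset (Fin (K + 1))).erase 0).card : ℕ) : ℝ) = K := by
    rw [Finset.card_erase_of_mem (mem_univ _), card_univ, Fintype.card_fin]; simp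
  have ha0' : a 0 = (K : ℝ) + t := by
    simp only [ha]; rw [hstart, hcard, if_pos (mem_univ _)]; ring
  have hb0' : b 0 = 1 := by simp only [hb]; rw [hstart, if_pos (mem_univ _)]
  have hq0' : q 0 = a 0 ^ 2 := by
    rw [ha0']; simp only [hq]; rw [hstart, hcard, if_pos (mem_univ _)]; ring
  have hb_nn : ∀ n, 0 ≤ b n := fun n => sum_nonneg fun D _ => mul_nonneg (hμ0 n D) (by split_ifs <;> norm_num)
  have hF0 : ∀ n, 0 ≤ F n := fun n => sum_nonneg fun D _ => mul_nonneg (hμ0 n D) (Nat.cast_nonneg _)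
  have ha00 : 0 ≤ a 0 := by rw [ha0']; linarith
  have hC₂0 : 0 ≤ 3 * (t * (1 - t)) + 2 * lam * t ^ 2 := by nlinarith [mul_pos ht0 (show 0 < 1 - t by linarith)]
  have hmain := stale_twoMoment_bounds (a := a) (b := b) (q := q) (F := F) ht0.le hlam0 (by linarith) hkap0 (mul_nonneg hlam0.le (by linarith)) hC₂0 ha00
    (by rw [hb0']; norm_num) hq0' hb_nn hF0 hFa hstepA hstepB hstepQ n
  rw [ha0', hb0'] at hmain
  exact ⟨hmain.1, hmain.2⟩

/-- **THE TWO MOMENTS OF THE STALE POTENTIAL:** `EΦ_n ≥ s = (1−t(1−t)/K)ⁿ(K+t)` and `EΦ_n² − (EΦ_n)² ≤ 16s + 9` (`0 < t < 1`, `K ≥ 2`, `m = cK`). [ours] -/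
theorem idealStar_stalePotential_moments (hm : 1 ≤ m) (ht0 : 0 < t) (ht1 : t < 1) (hK : 2 ≤ K)
    (hQ : ∀ D D', Q D D' = ∑ r : Fin m, t / m * (if D' = D.image (Equiv.swap (0 : Fin (K + 1)) (κ r).succ) then (1 : ℝ)
      else 0) + (1 - t) * (if D' = D.erase 0 then (1 : ℝ) else 0))
    {c : ℕ} (hunif : ∀ i : Fin K, (univ.filter fun r : Fin m => κ r = i).card = c) (hmc : m = c * K) (n : ℕ) :
    (1 - t * (1 - t) / K) ^ n * ((K : ℝ) + t)
        ≤ ∑ D, lawAt Q (Pi.single (univ : Finset (Fin (K + 1))) 1) n D * (((D.erase 0).card : ℝ) + t * (if (0 : Fin (K + 1)) ∈ D then (1 : ℝ) else 0)) ∧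
      ∑ D, lawAt Q (Pi.single (univ : Finset (Fin (K + 1))) 1) n D * (((D.erase 0).card : ℝ) + t * (if (0 : Fin (K + 1)) ∈ D then (1 : ℝ) else 0)) ^ 2
          - (∑ D, lawAt Q (Pi.single (univ : Finset (Fin (K + 1))) 1) n D * (((D.erase 0).card : ℝ) + t * (if (0 : Fin (K + 1)) ∈ D then (1 : ℝ) else 0))) ^ 2
        ≤ 16 * ((1 - t * (1 - t) / K) ^ n * ((K : ℝ) + t)) + 9 := by
  obtain ⟨h1, h2⟩ := idealStar_stalePotential_twoMoment κ hm ht0 ht1 hK hQ hunif hmc n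
  have hK2 : (2 : ℝ) ≤ K := by exact_mod_cast hK
  have hKpos : (0 : ℝ) < K := by linarith
  have hx0 : 0 ≤ (1 - t * (1 - t) / (K : ℝ)) ^ n := by
    apply pow_nonneg
    rw [sub_nonneg, div_le_one hKpos]; nlinarith [sq_nonneg (t - 1 / 2)]
  exact ⟨h1, h2.trans (stale_consts_le ht0 ht1 hK2 hx0)⟩

/-- **THE STALE LEVELS SURVIVE THE COUPON-COLLECTOR TIME IN THE UNIT `K/(t(1−t))`:** with `s = (1−t(1−t)/K)ⁿ(K+t)`,
**`(δ_{univ}Qⁿ){D : s/2 ≤ Φ(D)} ≥ 1 − (64s + 36)/s²`** (`0 < t < 1`, `K ≥ 2`, `m = cK`). [ours] -/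
theorem idealStar_stalePotential_mass_ge (hm : 1 ≤ m) (ht0 : 0 < t) (ht1 : t < 1) (hK : 2 ≤ K)
    (hQ : ∀ D D', Q D D' = ∑ r : Fin m, t / m * (if D' = D.image (Equiv.swap (0 : Fin (K + 1)) (κ r).succ) then (1 : ℝ)
      else 0) + (1 - t) * (if D' = D.erase 0 then (1 : ℝ) else 0))
    {c : ℕ} (hunif : ∀ i : Fin K, (univ.filter fun r : Fin m => κ r = i).card = c) (hmc : m = c * K) (n : ℕ) :
    1 - (64 * ((1 - t * (1 - t) / K) ^ n * ((K : ℝ) + t)) + 36) / ((1 - t * (1 - t) / K) ^ n * ((K : ℝ) + t)) ^ 2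
      ≤ ∑ D ∈ univ.filter (fun D : Finset (Fin (K + 1)) => (1 - t * (1 - t) / K) ^ n * ((K : ℝ) + t) / 2 ≤ ((D.erase 0).card : ℝ) + t * (if (0 : Fin (K + 1)) ∈ D then (1 : ℝ) else 0)),
          lawAt Q (Pi.single (univ : Finset (Fin (K + 1))) 1) n D := by
  classical
  obtain ⟨hmean, hvar⟩ := idealStar_stalePotential_moments κ hm ht0 ht1 hK hQ hunif hmc n
  have hQrs : IsRowStochastic Q := dirty_isRowStochastic κ hm ht0.le ht1.le hQ
  set μ := lawAt Q (Pi.single (univ : Finset (Fin (K + 1))) 1) n with hμ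
  set Φ : Finset (Fin (K + 1)) → ℝ := fun D => ((D.erase 0).card : ℝ) + t * (if (0 : Fin (K + 1)) ∈ D then (1 : ℝ) else 0) with hΦ
  set s : ℝ := (1 - t * (1 - t) / K) ^ n * ((K : ℝ) + t) with hs
  have hμ0 : ∀ D, 0 ≤ μ D := lawAt_nonneg hQrs (fun D => by rw [Pi.single_apply]; split_ifs <;> norm_num) n
  have hμ1 : ∑ D, μ D = 1 := by rw [hμ, sum_lawAt hQrs, Finset.sum_pi_single']; simp
  have hKpos : (0 : ℝ) < K := by exact_mod_cast (by omega : 0 < K)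
  have hK2 : (2 : ℝ) ≤ K := by exact_mod_cast hK
  have hspos : 0 < s := by
    have : 0 < 1 - t * (1 - t) / K := by
      rw [sub_pos, div_lt_one hKpos]; nlinarith [mul_pos ht0 (show 0 < 1 - t by linarith)]
    positivity
  set A : ℝ := ∑ D, μ D * Φ D with hA
  have hmean' : s ≤ A := hmean
  have hvar' : ∑ D, μ D * Φ D ^ 2 - A ^ 2 ≤ 16 * s + 9 := hvar
  -- Chebyshev
  have hvar'' : ∑ D, μ D * (Φ D - A) ^ 2 = ∑ D, μ D * Φ D ^ 2 - A ^ 2 := by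
    have e : ∀ D, μ D * (Φ D - A) ^ 2 = μ D * Φ D ^ 2 - 2 * A * (μ D * Φ D) + A ^ 2 * μ D := fun D => by ring
    rw [sum_congr rfl fun D _ => e D, sum_add_distrib, sum_sub_distrib, ← mul_sum, ← mul_sum, ← hA, hμ1]; ring
  have hbad : (∑ D ∈ univ.filter (fun D => ¬ (s / 2 ≤ Φ D)), μ D) * (s / 2) ^ 2 ≤ 16 * s + 9 := by
    rw [sum_mul]
    calc ∑ D ∈ univ.filter (fun D => ¬ (s / 2 ≤ Φ D)), μ D * (s / 2) ^ 2 ≤ ∑ D ∈ univ.filter (fun D => ¬ (s / 2 ≤ Φ D)), μ D * (Φ D - A) ^ 2 := by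
          refine sum_le_sum fun D hD => mul_le_mul_of_nonneg_left ?_ (hμ0 D)
          have hlt : Φ D < s / 2 := not_le.mp (mem_filter.mp hD).2
          have h1 : s / 2 ≤ A - Φ D := by linarith
          calc (s / 2) ^ 2 ≤ (A - Φ D) ^ 2 := pow_le_pow_left₀ (by linarith) h1 2
            _ = (Φ D - A) ^ 2 := by ring
      _ ≤ ∑ D, μ D * (Φ D - A) ^ 2 := sum_le_sum_of_subset_of_nonneg (filter_subset _ _) fun D _ _ => mul_nonneg (hμ0 D) (sq_nonneg _)
      _ ≤ 16 * s + 9 := by rw [hvar'']; exact hvar'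
  have hsplit := Finset.sum_filter_add_sum_filter_not univ (fun D => s / 2 ≤ Φ D) μ
  rw [hμ1] at hsplit
  have h4 : (∑ D ∈ univ.filter (fun D => ¬ (s / 2 ≤ Φ D)), μ D) ≤ (16 * s + 9) / (s / 2) ^ 2 := by
    rw [le_div_iff₀ (by positivity)]; exact hbad
  have e : (16 * s + 9) / (s / 2) ^ 2 = (64 * s + 36) / s ^ 2 := by field_simp; ring
  rw [e] at h4
  linarith

end StaleMoments

end Summit.Ventures.LatticeQCDFlow.Scaling

end
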